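import Literature.NumberTheory.EllipticCurves.VariableChangePoints
import HarnessLib

/-!
# Normal forms at a point of order `3` or `5`, and the Hauptmoduln of `X₀(3)` and `X₀(5)`

Elementary Weierstrass-equation algebra behind the classical moduli interpretation of `X₀(3)` and
`X₀(5)` (Klein, Fricke; Husemöller, *Elliptic Curves*, Ch. 4 §4 "Tate normal form"), used to turn a
Galois-stable subgroup of order `3` or `5` of an elliptic curve into a rational point of `X₀(3)`,
`X₀(5)` with explicit Hauptmodul value (file `TorsionPointHauptmodul`), and from there into a
rational point of `X₀(15) ≅ E₁` (file `XZeroFifteenExplicit`) — the moduli input of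
[Thorne 2019, Lemma 3].

* §1 The normalising change of variables `C_P = (1, x₀, λ, y₀)` at an affine point `P ≠ -P`:
  `C_P • W = [a₁ + 2λ, a₂ - λa₁ + 3x₀ - λ², y₀ - ȳ₀, 0, 0]`, `P ↦ (0, 0)`.
* §2 On `[a₁, a₂, a₃, 0, 0]`: `2·(0,0) = (-a₂, a₁a₂ - a₃)`; order `3` forces `a₂ = 0`; order `5`
  forces the Tate relation `a₂³ - a₁a₂a₃ + a₃² = 0` (`b = c` in `E(b, c)`).
* §3 `j`-invariants: `j · F = (F + 27)(F + 3)³` for `F = a₁³/a₃ - 27` (level `3`);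
  `j · t⁵(t² - 11t - 1) = (t⁴ - 12t³ + 14t² + 12t + 1)³` for the Tate parameter `t = -a₂³/a₃²`,
  and `j · H = (H² + 10H + 5)³` for `H = t - 11 - 1/t` (level `5`).
* §4 `τ₃ = (a₁ + 2λ)³/(y₀ - ȳ₀)` and `t` are unchanged under `P ↦ -P`.
* §5 `t` is covariant under `u = 1` changes of variables, and `t(2P) · t(P) = -1`.

All statements are identities between rational functions of the coefficients and coordinates,
proved by `field_simp`/`ring`/`linear_combination`. [folklore]
-/

noncomputable section

namespace WeierstrassCurve

variable {F : Type*} [Field F] [DecidableEq F] (W : WeierstrassCurve F)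

/-! ### §1. The normalising change of variables at a point `P ≠ -P`

For an affine point `P = (x₀, y₀)` of `W` with `P ≠ -P`, the change of variables
`C_P = (1, x₀, λ, y₀)`, `λ` the slope of the tangent at `P`, moves `P` to `(0, 0)` with horizontal
tangent: `C_P • W = [a₁ + 2λ, a₂ - λa₁ + 3x₀ - λ², 2y₀ + a₁x₀ + a₃, 0, 0]`
(Silverman, *AEC*, III.1 Table 3.1; the shape `y² + a₁'xy + a₃'y = x³ + a₂'x²` is the first step
of the Tate normal form, Husemöller, *Elliptic Curves*, Ch. 4 §4). -/

section Normalise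

variable {W}

/-- The `a₁`, `a₂`, `a₃` of `C_P • W` (definitional, `u = 1`). [folklore] -/
theorem variableChange_tangent_a₁ (x₀ y₀ : F) :
    ((⟨1, x₀, W.toAffine.slope x₀ x₀ y₀ y₀, y₀⟩ : VariableChange F) • W).a₁ =
      W.a₁ + 2 * W.toAffine.slope x₀ x₀ y₀ y₀ := by
  simp only [variableChange_a₁, inv_one, Units.val_one, one_mul]

/-- The `a₂` of `C_P • W`. [folklore] -/
theorem variableChange_tangent_a₂ (x₀ y₀ : F) :
    ((⟨1, x₀, W.toAffine.slope x₀ x₀ y₀ y₀, y₀⟩ : VariableChange F) • W).a₂ =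
      W.a₂ - W.toAffine.slope x₀ x₀ y₀ y₀ * W.a₁ + 3 * x₀ - W.toAffine.slope x₀ x₀ y₀ y₀ ^ 2 := by
  simp only [variableChange_a₂, inv_one, Units.val_one, one_pow, one_mul]

/-- The `a₃` of `C_P • W` is `2y₀ + a₁x₀ + a₃ = y₀ - (-y₀ - a₁x₀ - a₃)`. [folklore] -/
theorem variableChange_tangent_a₃ (x₀ y₀ : F) :
    ((⟨1, x₀, W.toAffine.slope x₀ x₀ y₀ y₀, y₀⟩ : VariableChange F) • W).a₃ =
      y₀ - W.toAffine.negY x₀ y₀ := by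
  simp only [variableChange_a₃, inv_one, Units.val_one, one_pow, one_mul, Affine.negY]
  ring

/-- The `a₄` of `C_P • W` vanishes: `λ` is the tangent slope (`P` on `W`, `P ≠ -P`).
[cite: SilvermanAEC2009, III.1 Table 3.1] -/
theorem variableChange_tangent_a₄ {x₀ y₀ : F} (hy : y₀ ≠ W.toAffine.negY x₀ y₀) :
    ((⟨1, x₀, W.toAffine.slope x₀ x₀ y₀ y₀, y₀⟩ : VariableChange F) • W).a₄ = 0 := by
  have hD : y₀ - W.toAffine.negY x₀ y₀ ≠ 0 := sub_ne_zero.2 hy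
  have hs : W.toAffine.slope x₀ x₀ y₀ y₀ * (y₀ - W.toAffine.negY x₀ y₀) =
      3 * x₀ ^ 2 + 2 * W.a₂ * x₀ + W.a₄ - W.a₁ * y₀ := by
    rw [Affine.slope_of_Y_ne rfl hy]
    exact div_mul_cancel₀ _ hD
  rw [variableChange_a₄]
  simp only [inv_one, Units.val_one, one_pow, one_mul]
  rw [Affine.negY] at hs
  linear_combination -hs

/-- The `a₆` of `C_P • W` vanishes: `P` lies on `W`. [cite: SilvermanAEC2009, III.1 Table 3.1] -/
theorem variableChange_tangent_a₆ {x₀ y₀ : F} (h : W.toAffine.Equation x₀ y₀) :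
    ((⟨1, x₀, W.toAffine.slope x₀ x₀ y₀ y₀, y₀⟩ : VariableChange F) • W).a₆ = 0 := by
  rw [variableChange_a₆]
  simp only [inv_one, Units.val_one, one_pow, one_mul]
  rw [Affine.equation_iff] at h
  linear_combination -h

/-- `C_P • W = [a₁ + 2λ, a₂ - λa₁ + 3x₀ - λ², y₀ - ȳ₀, 0, 0]`.
[cite: SilvermanAEC2009, III.1 Table 3.1] -/
theorem variableChange_tangent_eq {x₀ y₀ : F} (h : W.toAffine.Equation x₀ y₀)
    (hy : y₀ ≠ W.toAffine.negY x₀ y₀) :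
    ((⟨1, x₀, W.toAffine.slope x₀ x₀ y₀ y₀, y₀⟩ : VariableChange F) • W) =
      ⟨W.a₁ + 2 * W.toAffine.slope x₀ x₀ y₀ y₀,
        W.a₂ - W.toAffine.slope x₀ x₀ y₀ y₀ * W.a₁ + 3 * x₀ - W.toAffine.slope x₀ x₀ y₀ y₀ ^ 2,
        y₀ - W.toAffine.negY x₀ y₀, 0, 0⟩ := by
  ext
  · exact variableChange_tangent_a₁ x₀ y₀
  · exact variableChange_tangent_a₂ x₀ y₀
  · exact variableChange_tangent_a₃ x₀ y₀
  · exact variableChange_tangent_a₄ hy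
  · exact variableChange_tangent_a₆ h

/-- `C_P` moves `P` to `(0, 0)`: `pointEquiv W C_P (x₀, y₀) = (0, 0)`. [folklore] -/
theorem pointEquiv_tangent_some {x₀ y₀ : F} (h : W.toAffine.Nonsingular x₀ y₀) :
    ∃ h₀, VariableChange.pointEquiv W (⟨1, x₀, W.toAffine.slope x₀ x₀ y₀ y₀, y₀⟩ : VariableChange F)
      (.some _ _ h) = .some 0 0 h₀ := by
  refine ⟨?_, ?_⟩
  · have := (VariableChange.nonsingular_iff W
      (⟨1, x₀, W.toAffine.slope x₀ x₀ y₀ y₀, y₀⟩ : VariableChange F) x₀ y₀).mpr h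
    simpa [VariableChange.toX, VariableChange.toY] using this
  · rw [VariableChange.pointEquiv_some]
    congr 1 <;> simp [VariableChange.toX, VariableChange.toY]

end Normalise

/-! ### §2. The family `y² + a₁xy + a₃y = x³ + a₂x²` and the point `P₀ = (0, 0)` -/

section Family

variable {W}

omit [DecidableEq F] in
/-- `(0, 0)` lies on `W` when `a₆ = 0`. [folklore] -/
theorem equation_origin_of_a₆_eq_zero (h6 : W.a₆ = 0) : W.toAffine.Equation 0 0 :=
  Affine.equation_zero.2 h6

omit [DecidableEq F] in
/-- `(0, 0)` is nonsingular when `a₆ = 0` and `a₃ ≠ 0`. [folklore] -/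
theorem nonsingular_origin_of_a₃_ne_zero (h6 : W.a₆ = 0) (h3 : W.a₃ ≠ 0) :
    W.toAffine.Nonsingular 0 0 :=
  Affine.nonsingular_zero.2 ⟨h6, Or.inl h3⟩

/-- On `[a₁, a₂, a₃, 0, 0]` with `a₃ ≠ 0`: `-(0,0) = (0, -a₃)` and
`(0,0) + (0,0) = (-a₂, a₁a₂ - a₃)` (tangent `y = 0` meets the curve again at `(-a₂, 0)`).
Husemöller, *Elliptic Curves*, Ch. 4 §4 (the computation of `2P` on `E(b, c)`). [folklore] -/
theorem two_smul_zero_zero (h4 : W.a₄ = 0) (h6 : W.a₆ = 0) (h3 : W.a₃ ≠ 0) :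
    ∃ hQ, (Affine.Point.some _ _ (nonsingular_origin_of_a₃_ne_zero h6 h3) : W.toAffine.Point) +
        Affine.Point.some _ _ (nonsingular_origin_of_a₃_ne_zero h6 h3) =
      Affine.Point.some (-W.a₂) (W.a₁ * W.a₂ - W.a₃) hQ := by
  have hy : (0 : F) ≠ W.toAffine.negY 0 0 := by
    simp only [Affine.negY, mul_zero, sub_zero, neg_zero, zero_sub, ne_eq, zero_eq_neg]
    exact h3
  have hs : W.toAffine.slope 0 0 0 0 = 0 := by
    rw [Affine.slope_of_Y_ne rfl hy]
    simp [h4]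
  have hX : W.toAffine.addX 0 0 (W.toAffine.slope 0 0 0 0) = -W.a₂ := by
    rw [hs]; simp [Affine.addX]
  have hY : W.toAffine.addY 0 0 0 (W.toAffine.slope 0 0 0 0) = W.a₁ * W.a₂ - W.a₃ := by
    rw [Affine.addY, Affine.negAddY, hX, hs]
    simp [Affine.negY]
  refine ⟨?_, ?_⟩
  · have := Affine.nonsingular_add (nonsingular_origin_of_a₃_ne_zero h6 h3)
      (nonsingular_origin_of_a₃_ne_zero h6 h3) (fun hxy => hy hxy.2)
    rwa [hX, hY] at this
  · rw [Affine.Point.add_self_of_Y_ne hy]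
    congr 1

/-- **Order `3` criterion.** On `[a₁, a₂, a₃, 0, 0]` (`a₃ ≠ 0`): if `2·(0,0) = -(0,0)` then
`a₂ = 0` (compare `x`-coordinates `-a₂` and `0`). So a point of order `3` at the origin with
horizontal tangent forces the shape `y² + a₁xy + a₃y = x³` (the universal curve over
`X₁(3) = X₀(3)`,
Husemöller Ch. 4 §4). [folklore] -/
theorem a₂_eq_zero_of_two_smul_eq_neg (h4 : W.a₄ = 0) (h6 : W.a₆ = 0) (h3 : W.a₃ ≠ 0)
    (h : (Affine.Point.some _ _ (nonsingular_origin_of_a₃_ne_zero h6 h3) : W.toAffine.Point) +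
        Affine.Point.some _ _ (nonsingular_origin_of_a₃_ne_zero h6 h3) =
        -Affine.Point.some _ _ (nonsingular_origin_of_a₃_ne_zero h6 h3)) :
    W.a₂ = 0 := by
  obtain ⟨hQ, h2⟩ := two_smul_zero_zero h4 h6 h3
  rw [h2, Affine.Point.neg_some] at h
  have := (Affine.Point.some.injEq _ _ _ _ _ _).mp h
  exact neg_eq_zero.1 this.1

/-- **Order `5` criterion.** On `[a₁, a₂, a₃, 0, 0]` (`a₃ ≠ 0`), put `P₀ = (0,0)`,
`Q = 2P₀ = (-a₂, a₁a₂ - a₃)`. If `2P₀ ≠ -P₀` and `2Q = -P₀` (i.e. `P₀` has order `5`) then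
`a₂ ≠ 0`, `a₁a₂ - a₃ ≠ 0` and `a₂³ - a₁a₂a₃ + a₃² = 0` — the relation `b = c` of the Tate normal
form `E(b, c)` for `5`-torsion (Husemöller, *Elliptic Curves*, Ch. 4 §4, `E₁(5)`: `b = c`).
Proof: `x(2Q) = λ² + a₁λ + a₂` with `λ = (a₂² - a₁²a₂ + a₁a₃)/(a₁a₂ - a₃)`, and
`x(2Q) = 0` clears to `a₂(a₂³ - a₁a₂a₃ + a₃²) = 0`. [folklore] -/
theorem tate_relation_of_order_five (h4 : W.a₄ = 0) (h6 : W.a₆ = 0) (h3 : W.a₃ ≠ 0)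
    (hne : (Affine.Point.some _ _ (nonsingular_origin_of_a₃_ne_zero h6 h3) : W.toAffine.Point) +
        Affine.Point.some _ _ (nonsingular_origin_of_a₃_ne_zero h6 h3) ≠
        -Affine.Point.some _ _ (nonsingular_origin_of_a₃_ne_zero h6 h3))
    (h5 : ((Affine.Point.some _ _ (nonsingular_origin_of_a₃_ne_zero h6 h3) : W.toAffine.Point) +
        Affine.Point.some _ _ (nonsingular_origin_of_a₃_ne_zero h6 h3)) +
        ((Affine.Point.some _ _ (nonsingular_origin_of_a₃_ne_zero h6 h3) : W.toAffine.Point) +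
        Affine.Point.some _ _ (nonsingular_origin_of_a₃_ne_zero h6 h3)) =
        -Affine.Point.some _ _ (nonsingular_origin_of_a₃_ne_zero h6 h3)) :
    W.a₂ ≠ 0 ∧ W.a₁ * W.a₂ - W.a₃ ≠ 0 ∧ W.a₂ ^ 3 - W.a₁ * W.a₂ * W.a₃ + W.a₃ ^ 2 = 0 := by
  obtain ⟨hQ, h2⟩ := two_smul_zero_zero h4 h6 h3
  have hnegY : W.toAffine.negY (-W.a₂) (W.a₁ * W.a₂ - W.a₃) = 0 := by
    simp only [Affine.negY]; ring
  -- `a₂ ≠ 0`: otherwise `2P₀ = (0, -a₃) = -P₀`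
  have ha₂ : W.a₂ ≠ 0 := by
    intro ha
    apply hne
    rw [h2, Affine.Point.neg_some]
    congr 1
    · rw [ha, neg_zero]
    · simp [Affine.negY, ha]
  -- `Q ≠ -Q`: otherwise `2Q = 0 ≠ -P₀`
  have hD : W.a₁ * W.a₂ - W.a₃ ≠ 0 := by
    intro hD
    have hyQ : W.a₁ * W.a₂ - W.a₃ = W.toAffine.negY (-W.a₂) (W.a₁ * W.a₂ - W.a₃) := by
      rw [hnegY, hD]
    have h0 : ((Affine.Point.some _ _ hQ : W.toAffine.Point) + Affine.Point.some _ _ hQ) = 0 :=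
      Affine.Point.add_self_of_Y_eq hyQ
    rw [h2, h0] at h5
    exact (Affine.Point.some_ne_zero _) (neg_eq_zero.1 h5.symm)
  refine ⟨ha₂, hD, ?_⟩
  have hyQ : W.a₁ * W.a₂ - W.a₃ ≠ W.toAffine.negY (-W.a₂) (W.a₁ * W.a₂ - W.a₃) := by
    rwa [hnegY]
  rw [h2, Affine.Point.add_self_of_Y_ne hyQ, Affine.Point.neg_some] at h5
  have hx := ((Affine.Point.some.injEq _ _ _ _ _ _).mp h5).1
  -- `x(2Q) = λ² + a₁λ + a₂ = 0`, `λ (a₁a₂ - a₃) = a₂² - a₁²a₂ + a₁a₃`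
  set L := W.toAffine.slope (-W.a₂) (-W.a₂) (W.a₁ * W.a₂ - W.a₃) (W.a₁ * W.a₂ - W.a₃) with hLdef
  have hL : L * (W.a₁ * W.a₂ - W.a₃) = W.a₂ ^ 2 - W.a₁ ^ 2 * W.a₂ + W.a₁ * W.a₃ := by
    rw [hLdef, Affine.slope_of_Y_ne rfl hyQ, hnegY, sub_zero, div_mul_cancel₀ _ hD]
    simp only [h4]
    ring
  simp only [Affine.addX] at hx
  have key : W.a₂ * (W.a₂ ^ 3 - W.a₁ * W.a₂ * W.a₃ + W.a₃ ^ 2) = 0 := by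
    linear_combination (W.a₁ * W.a₂ - W.a₃) ^ 2 * hx -
      ((W.a₂ ^ 2 - W.a₁ ^ 2 * W.a₂ + W.a₁ * W.a₃) + L * (W.a₁ * W.a₂ - W.a₃) +
        W.a₁ * (W.a₁ * W.a₂ - W.a₃)) * hL
  exact (mul_eq_zero.1 key).resolve_left ha₂

end Family

/-! ### §3. `j`-invariants of the two normal forms: the Hauptmoduln of `X₀(3)` and `X₀(5)` -/

section Hauptmodul

variable {W}

omit [DecidableEq F] in
/-- **The `X₀(3)` relation.** For `W = [a₁, 0, a₃, 0, 0]` elliptic (the normal form at a point of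
order `3`): `Δ = a₃³(a₁³ - 27a₃)`, so `a₃ ≠ 0`, `F := a₁³/a₃ - 27 ≠ 0`, and
`j · F = (F + 27)(F + 3)³` — i.e. `j = τ(τ - 24)³/(τ - 27)` for the Hauptmodul `τ = a₁³/a₃` of
`X₁(3) = X₀(3)` (`F = τ - 27` is the canonical modular function `3⁶(η(3z)/η(z))¹²`, whose modular
equation is `j = (F + 27)(F + 3)³/F`: Klein/Fricke; cf. the `N = 3` canonical modular equation).
[folklore] -/
theorem j_mul_hauptmodul_three [W.IsElliptic] (h2 : W.a₂ = 0) (h4 : W.a₄ = 0) (h6 : W.a₆ = 0) :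
    W.a₃ ≠ 0 ∧ W.a₁ ^ 3 / W.a₃ - 27 ≠ 0 ∧
      W.j * (W.a₁ ^ 3 / W.a₃ - 27) =
        (W.a₁ ^ 3 / W.a₃ - 27 + 27) * (W.a₁ ^ 3 / W.a₃ - 27 + 3) ^ 3 := by
  have hΔ : W.Δ = W.a₃ ^ 3 * (W.a₁ ^ 3 - 27 * W.a₃) := by
    simp only [WeierstrassCurve.Δ, WeierstrassCurve.b₂, WeierstrassCurve.b₄, WeierstrassCurve.b₆,
      WeierstrassCurve.b₈, h2, h4, h6]
    ring
  have hΔ0 : W.Δ ≠ 0 := W.isUnit_Δ.ne_zero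
  rw [hΔ] at hΔ0
  have h3 : W.a₃ ≠ 0 := by
    intro h; apply hΔ0; rw [h]; ring
  have h27 : W.a₁ ^ 3 - 27 * W.a₃ ≠ 0 := fun h => hΔ0 (by rw [h, mul_zero])
  have hF' : W.a₁ ^ 3 / W.a₃ - 27 = (W.a₁ ^ 3 - 27 * W.a₃) / W.a₃ := by
    rw [eq_div_iff h3, sub_mul, div_mul_cancel₀ _ h3]
  have hF : W.a₁ ^ 3 / W.a₃ - 27 ≠ 0 := by
    rw [hF']; exact div_ne_zero h27 h3
  refine ⟨h3, hF, ?_⟩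
  have hc₄ : W.c₄ = W.a₁ ^ 4 - 24 * W.a₁ * W.a₃ := by
    simp only [WeierstrassCurve.c₄, WeierstrassCurve.b₂, WeierstrassCurve.b₄, h2, h4]
    ring
  rw [WeierstrassCurve.j, Units.val_inv_eq_inv_val, WeierstrassCurve.coe_Δ', hΔ, hc₄, hF']
  generalize hD : W.a₁ ^ 3 - 27 * W.a₃ = D at h27 ⊢
  field_simp
  subst hD
  ring

omit [DecidableEq F] in
/-- **The Tate parametrisation.** For `W = [a₁, a₂, a₃, 0, 0]` with `a₂a₃ ≠ 0` and the order-`5`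
relation `a₂³ - a₁a₂a₃ + a₃² = 0`: with `t := -a₂³/a₃²` and `u := a₃/a₂`,
`a₁ = (1 - t)u`, `a₂ = -tu²`, `a₃ = -tu³`, i.e. `W = E(t, t)` scaled by `u` (Tate normal form with
`b = c = t`, Husemöller Ch. 4 §4). [folklore] -/
theorem tate_parametrisation (h2 : W.a₂ ≠ 0) (h3 : W.a₃ ≠ 0)
    (hR : W.a₂ ^ 3 - W.a₁ * W.a₂ * W.a₃ + W.a₃ ^ 2 = 0) :
    W.a₁ = (1 - -W.a₂ ^ 3 / W.a₃ ^ 2) * (W.a₃ / W.a₂) ∧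
      W.a₂ = -(-W.a₂ ^ 3 / W.a₃ ^ 2) * (W.a₃ / W.a₂) ^ 2 ∧
        W.a₃ = -(-W.a₂ ^ 3 / W.a₃ ^ 2) * (W.a₃ / W.a₂) ^ 3 := by
  refine ⟨?_, ?_, ?_⟩
  · field_simp
    linear_combination -hR
  · field_simp
  · field_simp

omit [DecidableEq F] in
/-- **The `X₀(5)` relation.** For `W = [a₁, a₂, a₃, 0, 0]` elliptic with `a₂a₃ ≠ 0` and the
order-`5` relation `a₂³ - a₁a₂a₃ + a₃² = 0` (the normal form at a point of order `5`), let
`t := -a₂³/a₃²` (the Tate parameter, coordinate on `X₁(5)`): then `Δ = u¹²t⁵(t² - 11t - 1)`,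
so `t ≠ 0`, `t² - 11t - 1 ≠ 0`, and `j · t⁵(t² - 11t - 1) = (t⁴ - 12t³ + 14t² + 12t + 1)³`
(the `j`-invariant of the Tate normal form `E(t, t)`, Husemöller Ch. 4 §4). [folklore] -/
theorem j_mul_tate_five [W.IsElliptic] (h4 : W.a₄ = 0) (h6 : W.a₆ = 0) (h2 : W.a₂ ≠ 0)
    (h3 : W.a₃ ≠ 0) (hR : W.a₂ ^ 3 - W.a₁ * W.a₂ * W.a₃ + W.a₃ ^ 2 = 0) :
    -W.a₂ ^ 3 / W.a₃ ^ 2 ≠ 0 ∧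
      (-W.a₂ ^ 3 / W.a₃ ^ 2) ^ 2 - 11 * (-W.a₂ ^ 3 / W.a₃ ^ 2) - 1 ≠ 0 ∧
        W.j * ((-W.a₂ ^ 3 / W.a₃ ^ 2) ^ 5 *
            ((-W.a₂ ^ 3 / W.a₃ ^ 2) ^ 2 - 11 * (-W.a₂ ^ 3 / W.a₃ ^ 2) - 1)) =
          ((-W.a₂ ^ 3 / W.a₃ ^ 2) ^ 4 - 12 * (-W.a₂ ^ 3 / W.a₃ ^ 2) ^ 3 +
              14 * (-W.a₂ ^ 3 / W.a₃ ^ 2) ^ 2 + 12 * (-W.a₂ ^ 3 / W.a₃ ^ 2) + 1) ^ 3 := by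
  obtain ⟨ha₁, ha₂, ha₃⟩ := tate_parametrisation h2 h3 hR
  obtain ⟨u, hu⟩ : ∃ u : F, u = W.a₃ / W.a₂ := ⟨_, rfl⟩
  obtain ⟨t, ht⟩ : ∃ t : F, t = -W.a₂ ^ 3 / W.a₃ ^ 2 := ⟨_, rfl⟩
  rw [← hu, ← ht] at ha₁ ha₂ ha₃
  rw [← ht]
  have hu0 : u ≠ 0 := hu ▸ div_ne_zero h3 h2
  have ht0 : t ≠ 0 := ht ▸ div_ne_zero (neg_ne_zero.2 (pow_ne_zero 3 h2)) (pow_ne_zero 2 h3)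
  have hΔ : W.Δ = u ^ 12 * (t ^ 5 * (t ^ 2 - 11 * t - 1)) := by
    simp only [WeierstrassCurve.Δ, WeierstrassCurve.b₂, WeierstrassCurve.b₄, WeierstrassCurve.b₆,
      WeierstrassCurve.b₈, h4, h6]
    rw [ha₁, ha₂, ha₃]
    ring
  have hΔ0 : W.Δ ≠ 0 := W.isUnit_Δ.ne_zero
  rw [hΔ] at hΔ0
  have h11 : t ^ 2 - 11 * t - 1 ≠ 0 := fun h => hΔ0 (by rw [h, mul_zero, mul_zero])
  refine ⟨ht0, h11, ?_⟩
  have hc₄ : W.c₄ = u ^ 4 * (t ^ 4 - 12 * t ^ 3 + 14 * t ^ 2 + 12 * t + 1) := by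
    simp only [WeierstrassCurve.c₄, WeierstrassCurve.b₂, WeierstrassCurve.b₄, h4]
    rw [ha₁, ha₂, ha₃]
    ring
  rw [WeierstrassCurve.j, Units.val_inv_eq_inv_val, WeierstrassCurve.coe_Δ', hΔ, hc₄]
  have hX : t ^ 5 * (t ^ 2 - 11 * t - 1) ≠ 0 := mul_ne_zero (pow_ne_zero 5 ht0) h11
  generalize t ^ 5 * (t ^ 2 - 11 * t - 1) = X at hX ⊢
  field_simp

omit [DecidableEq F] in
/-- **From the Tate parameter to the Hauptmodul of `X₀(5)`.** If `t ≠ 0`, `t² - 11t - 1 ≠ 0` and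
`j t⁵ (t² - 11t - 1) = (t⁴ - 12t³ + 14t² + 12t + 1)³`, then `H := (t² - 11t - 1)/t = t - 11 - 1/t`
(invariant under the deck involution `t ↦ -1/t` of `X₁(5) → X₀(5)`) satisfies `H ≠ 0` and
`j · H = (H² + 10H + 5)³` — the canonical modular equation of level `5`
(`H = 5³(η(5z)/η(z))⁶`, Klein's icosahedral relation). [folklore] -/
theorem j_mul_hauptmodul_five {j t : F} (ht : t ≠ 0) (h11 : t ^ 2 - 11 * t - 1 ≠ 0)
    (hj : j * (t ^ 5 * (t ^ 2 - 11 * t - 1)) = (t ^ 4 - 12 * t ^ 3 + 14 * t ^ 2 + 12 * t + 1) ^ 3) :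
    (t ^ 2 - 11 * t - 1) / t ≠ 0 ∧
      j * ((t ^ 2 - 11 * t - 1) / t) =
        (((t ^ 2 - 11 * t - 1) / t) ^ 2 + 10 * ((t ^ 2 - 11 * t - 1) / t) + 5) ^ 3 := by
  refine ⟨div_ne_zero h11 ht, ?_⟩
  field_simp
  linear_combination hj

end Hauptmodul

/-! ### §4. The invariants `τ₃(P) = a₁'³/a₃'` and `t(P) = -a₂'³/a₃'²` do not see the sign of `P` -/

section Negation

variable {W}

/-- The tangent slope at `-P = (x₀, ȳ₀)` is `-λ - a₁`. [folklore] -/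
theorem slope_negY_negY {x₀ y₀ : F} (hy : y₀ ≠ W.toAffine.negY x₀ y₀) :
    W.toAffine.slope x₀ x₀ (W.toAffine.negY x₀ y₀) (W.toAffine.negY x₀ y₀) =
      -W.toAffine.slope x₀ x₀ y₀ y₀ - W.a₁ := by
  have hy' : W.toAffine.negY x₀ y₀ ≠ W.toAffine.negY x₀ (W.toAffine.negY x₀ y₀) := by
    rw [Affine.negY_negY]; exact hy.symm
  rw [Affine.slope_of_Y_ne rfl hy', Affine.slope_of_Y_ne rfl hy, Affine.negY_negY]
  have hD : y₀ - W.toAffine.negY x₀ y₀ ≠ 0 := sub_ne_zero.2 hy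
  have hyb : W.toAffine.negY x₀ y₀ = y₀ - (y₀ - W.toAffine.negY x₀ y₀) := by ring
  generalize y₀ - W.toAffine.negY x₀ y₀ = D at hD hyb ⊢
  rw [hyb, show y₀ - D - y₀ = -D by ring, div_neg]
  field_simp
  ring

/-- `τ₃(-P) = τ₃(P)`: `(a₁ + 2λ)³/(y₀ - ȳ₀)` is unchanged under `y₀ ↦ ȳ₀` (`λ ↦ -λ - a₁`,
`y₀ - ȳ₀ ↦ ȳ₀ - y₀`). [folklore] -/
theorem tau_three_negY {x₀ y₀ : F} (hy : y₀ ≠ W.toAffine.negY x₀ y₀) :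
    (W.a₁ + 2 * W.toAffine.slope x₀ x₀ (W.toAffine.negY x₀ y₀) (W.toAffine.negY x₀ y₀)) ^ 3 /
        (W.toAffine.negY x₀ y₀ - W.toAffine.negY x₀ (W.toAffine.negY x₀ y₀)) =
      (W.a₁ + 2 * W.toAffine.slope x₀ x₀ y₀ y₀) ^ 3 / (y₀ - W.toAffine.negY x₀ y₀) := by
  rw [slope_negY_negY hy, Affine.negY_negY, ← neg_sub y₀, div_neg, ← neg_div]
  congr 1
  ring

/-- `t(-P) = t(P)`: `-(a₂ - λa₁ + 3x₀ - λ²)³/(y₀ - ȳ₀)²` is unchanged under `y₀ ↦ ȳ₀`. [folklore] -/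
theorem tate_t_negY {x₀ y₀ : F} (hy : y₀ ≠ W.toAffine.negY x₀ y₀) :
    -(W.a₂ - W.toAffine.slope x₀ x₀ (W.toAffine.negY x₀ y₀) (W.toAffine.negY x₀ y₀) * W.a₁ +
          3 * x₀ - W.toAffine.slope x₀ x₀ (W.toAffine.negY x₀ y₀) (W.toAffine.negY x₀ y₀) ^ 2) ^ 3 /
        (W.toAffine.negY x₀ y₀ - W.toAffine.negY x₀ (W.toAffine.negY x₀ y₀)) ^ 2 =
      -(W.a₂ - W.toAffine.slope x₀ x₀ y₀ y₀ * W.a₁ + 3 * x₀ -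
          W.toAffine.slope x₀ x₀ y₀ y₀ ^ 2) ^ 3 / (y₀ - W.toAffine.negY x₀ y₀) ^ 2 := by
  rw [slope_negY_negY hy, Affine.negY_negY, ← neg_sub y₀, neg_sq]
  congr 2
  ring

end Negation

/-! ### §5. `t(2P) = -1/t(P)`: covariance under `(1, r, s, t)`-changes, doubling on `E(t,t)` -/

section Doubling

variable {W}

/-- The invariant `t = -(a₂ - λa₁ + 3x - λ²)³/(y - ȳ)²` is unchanged by a change of variables with
`u = 1` (slopes shift by `-s`, `y - ȳ` is invariant). [folklore] -/
theorem tate_t_toXY (C : VariableChange F) (hu : C.u = 1) {x y : F} (h : W.toAffine.Equation x y)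
    (hy : y ≠ W.toAffine.negY x y) :
    -((C • W).a₂ - (C • W).toAffine.slope (C.toX x) (C.toX x) (C.toY x y) (C.toY x y) * (C • W).a₁ +
          3 * C.toX x -
            (C • W).toAffine.slope (C.toX x) (C.toX x) (C.toY x y) (C.toY x y) ^ 2) ^ 3 /
        (C.toY x y - (C • W).toAffine.negY (C.toX x) (C.toY x y)) ^ 2 =
      -(W.a₂ - W.toAffine.slope x x y y * W.a₁ + 3 * x - W.toAffine.slope x x y y ^ 2) ^ 3 /
        (y - W.toAffine.negY x y) ^ 2 := by
  rw [VariableChange.slope_toXY W C h h (fun hh => hy hh.2), VariableChange.negY_toXY]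
  simp only [VariableChange.toX, VariableChange.toY, variableChange_a₁, variableChange_a₂, hu,
    inv_one, Units.val_one, one_pow, one_mul]
  congr 2 <;> ring

/-- **The doubling on the order-`5` normal form.** For `V = [a₁, a₂, a₃, 0, 0]` with `a₂a₃ ≠ 0`,
`a₁a₂ - a₃ ≠ 0` and `a₂³ - a₁a₂a₃ + a₃² = 0`, the invariant `t` at `Q = 2P₀ = (-a₂, a₁a₂ - a₃)` and
at `P₀ = (0,0)` satisfy `t(Q) · t(P₀) = -1` (on `E(t,t)`: `2·(0,0) = (t, t²)` has Tate parameter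
`-1/t`, the deck involution of `X₁(5) → X₀(5)`). [folklore] -/
theorem tate_t_double (h4 : W.a₄ = 0) (h2 : W.a₂ ≠ 0) (h3 : W.a₃ ≠ 0)
    (hD : W.a₁ * W.a₂ - W.a₃ ≠ 0) (hR : W.a₂ ^ 3 - W.a₁ * W.a₂ * W.a₃ + W.a₃ ^ 2 = 0) :
    (-(W.a₂ - W.toAffine.slope (-W.a₂) (-W.a₂) (W.a₁ * W.a₂ - W.a₃) (W.a₁ * W.a₂ - W.a₃) * W.a₁ +
          3 * -W.a₂ -
            W.toAffine.slope (-W.a₂) (-W.a₂) (W.a₁ * W.a₂ - W.a₃) (W.a₁ * W.a₂ - W.a₃) ^ 2) ^ 3 /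
        (W.a₁ * W.a₂ - W.a₃ - W.toAffine.negY (-W.a₂) (W.a₁ * W.a₂ - W.a₃)) ^ 2) *
      (-W.a₂ ^ 3 / W.a₃ ^ 2) = -1 := by
  have hnegY : W.toAffine.negY (-W.a₂) (W.a₁ * W.a₂ - W.a₃) = 0 := by
    simp only [Affine.negY]; ring
  have hyQ : W.a₁ * W.a₂ - W.a₃ ≠ W.toAffine.negY (-W.a₂) (W.a₁ * W.a₂ - W.a₃) := by
    rwa [hnegY]
  obtain ⟨ha₁, ha₂, ha₃⟩ := tate_parametrisation h2 h3 hR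
  obtain ⟨u, hu⟩ : ∃ u : F, u = W.a₃ / W.a₂ := ⟨_, rfl⟩
  obtain ⟨t, ht⟩ : ∃ t : F, t = -W.a₂ ^ 3 / W.a₃ ^ 2 := ⟨_, rfl⟩
  rw [← hu, ← ht] at ha₁ ha₂ ha₃
  rw [← ht]
  have hu0 : u ≠ 0 := hu ▸ div_ne_zero h3 h2
  have ht0 : t ≠ 0 := ht ▸ div_ne_zero (neg_ne_zero.2 (pow_ne_zero 3 h2)) (pow_ne_zero 2 h3)
  have hL : W.toAffine.slope (-W.a₂) (-W.a₂) (W.a₁ * W.a₂ - W.a₃) (W.a₁ * W.a₂ - W.a₃) =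
      t * u := by
    rw [Affine.slope_of_Y_ne rfl hyQ, hnegY, sub_zero, div_eq_iff hD]
    simp only [h4, ha₁, ha₂, ha₃]
    ring
  have hDQ : W.a₁ * W.a₂ - W.a₃ = t ^ 2 * u ^ 3 := by rw [ha₁, ha₂, ha₃]; ring
  have hAQ : W.a₂ - t * u * W.a₁ + 3 * -W.a₂ - (t * u) ^ 2 = t * u ^ 2 := by rw [ha₁, ha₂]; ring
  rw [hL, hnegY, sub_zero, hDQ, hAQ, div_mul_eq_mul_div,
    div_eq_iff (pow_ne_zero 2 (mul_ne_zero (pow_ne_zero 2 ht0) (pow_ne_zero 3 hu0)))]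
  ring

end Doubling


end WeierstrassCurve

end
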